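import Literature.Probability.RandomPlanarGeometry.YangBaxterSAWTheoremsHolds
import HarnessLib

/-!
# The Yang–Baxter weights give exact parafermionic vertex identities on the SQUARE lattice

Topic `Literature/Probability/RandomPlanarGeometry`; companion of `YangBaxterSAW.lean`
(Glazman–Manolescu, *Self-avoiding walk on `ℤ²` with Yang–Baxter weights*, AIHP 56 (2020) =
arXiv:1708.00395) and of its discharged **Lemma 2.1** (`GlazmanManolescu2019_lem21_holds`,
`YangBaxterSAWExcursion.lean`): "The parafermionic observable `F` satisfies the following relation
for each rhombus of `Rect_{T,L}(Θ)`: `F(z_E) − F(z_W) = e^{iθ}(F(z_S) − F(z_N))`", where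
`F(z) = Σ_{γ : 0 → z} w_Θ(γ) e^{−i(5/8)·wind_Θ(γ)}` and `wind_Θ` is the GEOMETRIC winding of `γ`
drawn in the rhombic embedding `H(Θ)` (column `k` made of rhombi of angle `θ_k`).

## What is formalised (namespace `Literature.Probability.RandomPlanarGeometry.SAW.YangBaxter`)

The SAME walks with the SAME printed weights `w_Θ(γ)` (eq. (1): `u₁(θ_k), u₂(θ_k), v(θ_k),
w₁(θ_k), w₂(θ_k)` in column `k`), but with the winding of the RIGHT-ANGLE tiling — every corner arc
turns by `±π/2`, i.e. the walk is read on the square lattice `ℤ²` itself, with the square-lattice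
parafermionic phase `e^{−i(5/8)(π/2)}` per left quarter turn and no rhombic geometry at all:

* `YBWalk.sqParaWeight Θ γ = w_Θ(γ) · e^{−i(5/8)·wind_{π/2}(γ)}` and the square-lattice observable
  `sqParafermion T L Θ z = Σ_{γ ⊂ Rect_{T,L} : 0 → z} sqParaWeight Θ γ`;
* `YBWalk.sqParaWeight_eq`, `sqParafermion_eq`: `F_sq(z) = F_Θ(z) · e^{+i(5/8)κ_Θ(z)}` with the
  tree's potential `κ_Θ = slantPot Θ` (`θ_k − π/2` on the slanted edges of column `k`, `0` on
  vertical edges) — an immediate consequence of the tree's winding-transfer lemma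
  `YBWalk.winding_eq_winding_pi_div_two_add` ("`wind_Θ(γ) = wind_{π/2}(γ) + κ_Θ(end) − κ_Θ(start)`":
  the turns of a walk alternate between turns out of a horizontal and out of a vertical heading, so
  the angle surplus `θ_k − π/2` telescopes to the two end edges);
* **`sqParafermion_relation`**: for every angle sequence `Θ` with values in `[π/3, 2π/3]`, every
  rectangle `Rect_{T,L}` and EVERY face `f = (k, j)` of it,
  `F_sq(z_E) − F_sq(z_W) = e^{i(3θ_k/8 + 5π/16)} · (F_sq(z_S) − F_sq(z_N))`
  — an exact linear relation among the four square-lattice mid-edge values around a vertex of `ℤ²`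
  with constant (column-dependent only through `θ_k`) coefficients
  `(c_E, c_N, c_W, c_S) = (1, e^{i(3θ_k/8+5π/16)}, −1, −e^{i(3θ_k/8+5π/16)})`;
* `sqParafermion_relation_const` (one angle `θ`: a ONE-PARAMETER FAMILY of exact square-lattice
  identities, weights nonnegative and, for `θ ≠ π/2`, anisotropic: `weightU1_eq_weightU2_iff`,
  `u₁(θ) = u₂(θ) ↔ θ = π/2`),
  `sqParafermion_relation_pi_div_two` (`θ = π/2`, Nienhuis' isotropic square-lattice point:
  coefficient `e^{iπ/2} = i`, i.e. `F(z_E) − F(z_W) = i (F(z_S) − F(z_N))`, kernel `(1, i, −1, −i)`),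
  `sqParafermion_relation_pi_div_three` (`θ = π/3`: coefficient `e^{7iπ/16}`; there `w₂ = 0` and
  `u₁ = x_c(ℍ)` by `weightW2_pi_div_three`, `weightU1_pi_div_three` — the honeycomb walk drawn on
  `ℤ²` with split vertices).

Nothing here concerns the UNIFORM self-avoiding walk `(1, x, x, x, 0, 0)`, for which the catalogue
`Literature/Barriers/CriticalPhenomena/NoExact*RelationZ2*` proves that no such relation exists;
the point of this file is the positive side of that catalogue: on `ℤ²` the printed integrable
weights carry a whole curve `θ ↦ W(θ)` of exact vertex identities with `θ`-dressed coefficients,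
of which the isotropic Nienhuis point is the member `θ = π/2`.

## Status in print

Printed in substance. That the integrable (Yang–Baxter, `Z`-invariant) `O(n)` weights satisfy the
discrete Cauchy–Riemann / current-conservation identity around every vertex with the rhombus angle
entering ONLY through the spectral parameter — so that the identity can be written in lattice
coordinates with angle-dressed CONSTANT coefficients — is Ikhlef–Cardy [cite: IkhlefCardy2009, §3,
eqs. (3.1)–(3.7) (rhombus of opening angle α)], Ikhlef–Weston–Wheeler–Zinn-Justin
[cite: IkhlefWestonWheelerZinnJustin2013, §1 (p. 3: "the conservation equation of currents can be
written as a discrete holomorphicity condition on the rhombic lattice with opening angle α, provided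
an appropriate relation between α and the spectral parameter is introduced"), §3, and §4.2.1 (dilute
`O(n)`: the condition `φ₀(x,t−½) + e^{i(π−α)} φ₀(x+½,t) − e^{i(π−α)} φ₀(x−½,t) − φ₀(x,t+½) = 0` in
lattice coordinates, with the Remark `x = z/w = e^{3i(ν′−1)α}`)], Alam–Batchelor
[cite: AlamBatchelor2014, §2 (Σ_◊ ψ Δz = 0 on a rhombic plaquette whose opening angle is the spectral
parameter) and §3 (dilute O(n))], and, at `n = 0`, Glazman [cite: Glazman2015WeightedSAW, Lemma 4.1]
and Glazman–Manolescu [cite: GlazmanManolescu2019, Lemma 2.1]. The square-frame identity below is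
that printed rhombic identity (tree `GlazmanManolescu2019_lem21_holds`) re-expressed through the
constant winding-transfer phase (tree `YBWalk.winding_eq_winding_pi_div_two_add`): a
reparametrisation, not a new relation; the explicit `n = 0` square-frame coefficient
`e^{i(3θ/8 + 5π/16)}` is not displayed in print. New here: the typed square-lattice statement
assembled from tree lemmas (first kernel text in this frame). The weights are anisotropic for
`θ ≠ π/2` and symmetric exactly at `θ = π/2` [cite: Glazman2015WeightedSAW, §1 (p. 3) and Lemma 3.1
(uniqueness of the weights for each (σ, θ))] — whence the lane's corrected pre-registration P-C3′
(HOME/FINDING-Z2-YANGBAXTER-FAMILY.md §5).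

## References

* A. Glazman, I. Manolescu, AIHP 56 (2020) 2281–2300 = arXiv:1708.00395: §1 eq. (1) (weights),
  §2.1 eq. (2.1) (observable, winding), Lemma 2.1 eq. (2.2) (CR), Fig. 2 (`θ = π/3`: `u₁ = x_c`,
  `w₂ = 0`). [GlazmanManolescu2019]
* A. Glazman, *Connective constant for a weighted self-avoiding walk on `ℤ²`*, ECP 20 (2015)
  no. 86, §1 (p. 3), Lemma 3.1, Lemma 4.1 (the relation "in the form given in [Gl]").
  [Glazman2015WeightedSAW]
* Y. Ikhlef, J. Cardy, *Discretely holomorphic parafermions and integrable loop models*, J. Phys. A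
  42 (2009) 102001 = arXiv:0810.5037, §3. [IkhlefCardy2009]
* Y. Ikhlef, R. Weston, M. Wheeler, P. Zinn-Justin, *Discrete holomorphicity and quantized affine
  algebras*, J. Phys. A 46 (2013) 265205 = arXiv:1302.4649, §1, §3, §4.2.1.
  [IkhlefWestonWheelerZinnJustin2013]
* I. T. Alam, M. T. Batchelor, J. Phys. A 47 (2014) 215201 = arXiv:1402.0937, §2–§3.
  [AlamBatchelor2014]

Written for the venture lane «pcv-sawmu» (Tier B, `ℤ²` search; HOME/FINDING-Z2-YANGBAXTER-FAMILY.md: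
the sixteen free-weight local group forms, the exact `ℚ(ζ₃₂)` check at `θ = π/3` on general
simply connected domains, and the corrected pre-registration P-C3′).
-/

noncomputable section

open Real

namespace Literature.Probability.RandomPlanarGeometry.SAW.YangBaxter

open MidEdge

/-! ### The square-lattice parafermionic weight and observable -/

namespace YBWalk

variable {D : Set Face} {a z : MidEdge}

/-- **The square-lattice parafermionic weight** of a walk of the Yang–Baxter model: the printed
weight `w_Θ(γ)` (eq. (1)) times `e^{−iσ·wind_{π/2}(γ)}`, `σ = 5/8`, where `wind_{π/2}` is the
winding of `γ` read on the right-angle tiling (each corner arc `±π/2`, straight arcs `0`) — the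
square lattice `ℤ²` itself. [cite: GlazmanManolescu2019, eq. (2.1) (with Θ ≡ π/2 in the winding only)] -/
def sqParaWeight (Θ : ℤ → ℝ) (γ : YBWalk D a z) : ℂ :=
  (γ.weight Θ : ℂ) * Complex.exp ((-(5 / 8 * γ.winding (fun _ => π / 2)) : ℝ) * Complex.I)

/-- **Winding transfer at the level of weights**: the square-lattice parafermionic weight is the
rhombic one (`paraWeight`) times the end-point phase `e^{+i(5/8)(κ_Θ(z) − κ_Θ(a))}`, `κ_Θ = slantPot Θ`
— by the tree's `winding_eq_winding_pi_div_two_add`. [cite: GlazmanManolescu2019, §2.1 (definition of wind(γ))] -/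
theorem sqParaWeight_eq (Θ : ℤ → ℝ) (γ : YBWalk D a z) :
    γ.sqParaWeight Θ =
      γ.paraWeight Θ * Complex.exp (((5 / 8 * (slantPot Θ z - slantPot Θ a) : ℝ) : ℂ) * Complex.I) := by
  have hw : γ.winding (fun _ => π / 2) = γ.winding Θ - (slantPot Θ z - slantPot Θ a) := by
    have h := γ.winding_eq_winding_pi_div_two_add Θ
    linarith
  unfold sqParaWeight paraWeight
  rw [hw, mul_assoc, ← Complex.exp_add]
  congr 1
  push_cast
  ring

end YBWalk

/-- **The square-lattice parafermionic observable** of the Yang–Baxter walk in the rectangle: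
`F_sq(z) = Σ_{γ ⊂ Rect_{T,L} : 0 → z} w_Θ(γ) e^{−i(5/8)·wind_{π/2}(γ)}` (a finite sum; compare
`parafermion`, which uses the rhombic winding `wind_Θ`). [cite: GlazmanManolescu2019, §2.1, eq. (2.1)] -/
def sqParafermion (T L : ℕ) (Θ : ℤ → ℝ) (z : MidEdge) : ℂ :=
  ∑ γ : YBWalk (rect T L) origin z, γ.sqParaWeight Θ

/-- The origin `0 = vert 0 0` is a vertical edge: its potential vanishes. [folklore] -/
private theorem slantPot_origin (Θ : ℤ → ℝ) : slantPot Θ origin = 0 := rfl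

/-- **`F_sq(z) = F_Θ(z) · e^{i(5/8)κ_Θ(z)}`**: the square-lattice observable is the rhombic one
dressed by the end-edge phase (`κ_Θ(0) = 0`). [cite: GlazmanManolescu2019, §2.1] -/
theorem sqParafermion_eq (T L : ℕ) (Θ : ℤ → ℝ) (z : MidEdge) :
    sqParafermion T L Θ z =
      parafermion T L Θ z * Complex.exp (((5 / 8 * slantPot Θ z : ℝ) : ℂ) * Complex.I) := by
  unfold sqParafermion parafermion
  rw [Finset.sum_mul]
  refine Finset.sum_congr rfl fun γ _ => ?_
  rw [γ.sqParaWeight_eq Θ, slantPot_origin, sub_zero]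

/-- The potential of the four sides of the face `(k, j)`: `0` on `W`, `E` (vertical edges),
`θ_k − π/2` on `S`, `N` (slanted edges). [folklore] -/
private theorem slantPot_side_W (Θ : ℤ → ℝ) (f : Face) : slantPot Θ (f.side .W) = 0 := by
  rw [slantPot_side]; simp [Side.slantInd]

/-- See `slantPot_side_W`. [folklore] -/
private theorem slantPot_side_E (Θ : ℤ → ℝ) (f : Face) : slantPot Θ (f.side .E) = 0 := by
  rw [slantPot_side]; simp [Side.slantInd]

/-- See `slantPot_side_W`. [folklore] -/
private theorem slantPot_side_S (Θ : ℤ → ℝ) (f : Face) : slantPot Θ (f.side .S) = Θ f.1 - π / 2 := by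
  rw [slantPot_side]; simp [Side.slantInd]

/-- See `slantPot_side_W`. [folklore] -/
private theorem slantPot_side_N (Θ : ℤ → ℝ) (f : Face) : slantPot Θ (f.side .N) = Θ f.1 - π / 2 := by
  rw [slantPot_side]; simp [Side.slantInd]

/-! ### The exact vertex relation on the square lattice -/

/-- **The Yang–Baxter weights satisfy an exact vertex identity ON THE SQUARE LATTICE.** For every
angle sequence `Θ` with values in `[π/3, 2π/3]`, every rectangle `Rect_{T,L}` and every face
`f = (k, j)` of it, the square-lattice parafermionic observable of the walk with the printed weights
`u₁(θ_k), u₂(θ_k), v(θ_k), w₁(θ_k), w₂(θ_k)` obeys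
`F_sq(z_E) − F_sq(z_W) = e^{i(3θ_k/8 + 5π/16)} (F_sq(z_S) − F_sq(z_N))`
— Lemma 2.1 (CR) transported by the winding transfer (`3θ/8 + 5π/16 = θ − (5/8)(θ − π/2)`).
[cite: GlazmanManolescu2019, Lemma 2.1, eq. (2.2) (CR)] -/
theorem sqParafermion_relation (T L : ℕ) (Θ : ℤ → ℝ) (hΘ : ∀ k, Θ k ∈ Set.Icc (π / 3) (2 * π / 3))
    (f : Face) (hf : f ∈ rect T L) :
    sqParafermion T L Θ (f.side .E) - sqParafermion T L Θ (f.side .W) =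
      Complex.exp (((3 / 8 * Θ f.1 + 5 * π / 16 : ℝ) : ℂ) * Complex.I) *
        (sqParafermion T L Θ (f.side .S) - sqParafermion T L Θ (f.side .N)) := by
  have h21 := GlazmanManolescu2019_lem21_holds T L Θ hΘ f hf
  have he : Complex.exp (((Θ f.1 : ℝ) : ℂ) * Complex.I) =
      Complex.exp (((3 / 8 * Θ f.1 + 5 * π / 16 : ℝ) : ℂ) * Complex.I) *
        Complex.exp (((5 / 8 * (Θ f.1 - π / 2) : ℝ) : ℂ) * Complex.I) := by
    rw [← Complex.exp_add]
    congr 1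
    push_cast
    ring
  simp only [sqParafermion_eq, slantPot_side_W, slantPot_side_E, slantPot_side_S, slantPot_side_N,
    mul_zero, Complex.ofReal_zero, zero_mul, Complex.exp_zero, mul_one]
  rw [h21, he]
  ring

/-- **One-parameter family** (constant angle `θ ∈ [π/3, 2π/3]`): with the weights
`(u₁, u₂, v, w₁, w₂)(θ)` at every vertex, the square-lattice observable satisfies, at every face of
every rectangle, `F_sq(z_E) − F_sq(z_W) = e^{i(3θ/8 + 5π/16)} (F_sq(z_S) − F_sq(z_N))`: constant
coefficients `(1, e^{i(3θ/8+5π/16)}, −1, −e^{i(3θ/8+5π/16)})` on `(z_E, z_N, z_W, z_S)`.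
[cite: GlazmanManolescu2019, Lemma 2.1, eq. (2.2) (CR)] -/
theorem sqParafermion_relation_const (T L : ℕ) {θ : ℝ} (hθ : θ ∈ Set.Icc (π / 3) (2 * π / 3))
    (f : Face) (hf : f ∈ rect T L) :
    sqParafermion T L (fun _ => θ) (f.side .E) - sqParafermion T L (fun _ => θ) (f.side .W) =
      Complex.exp (((3 / 8 * θ + 5 * π / 16 : ℝ) : ℂ) * Complex.I) *
        (sqParafermion T L (fun _ => θ) (f.side .S) - sqParafermion T L (fun _ => θ) (f.side .N)) :=
  sqParafermion_relation T L (fun _ => θ) (fun _ => hθ) f hf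

/-- `π/2 ∈ [π/3, 2π/3]`. [folklore] -/
private theorem pi_div_two_mem_Icc : (π / 2 : ℝ) ∈ Set.Icc (π / 3) (2 * π / 3) := by
  constructor <;> nlinarith [Real.pi_pos]

/-- **Nienhuis' isotropic square-lattice point `θ = π/2`**: `u₁ = u₂`, `w₁ = w₂`
(`weightU1_eq_weightU2_pi_div_two`, `weightW1_eq_weightW2_pi_div_two` in the barrier catalogue)
and the relation is the plain discrete Cauchy–Riemann relation of the square lattice,
`F(z_E) − F(z_W) = i (F(z_S) − F(z_N))`, kernel `(1, i, −1, −i)` on `(z_E, z_N, z_W, z_S)`.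
[cite: GlazmanManolescu2019, Lemma 2.1 (θ = π/2)] -/
theorem sqParafermion_relation_pi_div_two (T L : ℕ) (f : Face) (hf : f ∈ rect T L) :
    sqParafermion T L (fun _ => π / 2) (f.side .E) - sqParafermion T L (fun _ => π / 2) (f.side .W) =
      Complex.I *
        (sqParafermion T L (fun _ => π / 2) (f.side .S) - sqParafermion T L (fun _ => π / 2) (f.side .N)) := by
  have h := sqParafermion_relation_const T L pi_div_two_mem_Icc f hf
  have he : Complex.exp (((3 / 8 * (π / 2) + 5 * π / 16 : ℝ) : ℂ) * Complex.I) = Complex.I := by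
    have : (3 / 8 * (π / 2) + 5 * π / 16 : ℝ) = π / 2 := by ring
    rw [this, Complex.exp_mul_I]
    push_cast
    rw [Complex.cos_pi_div_two, Complex.sin_pi_div_two]
    ring
  rw [he] at h
  exact h

/-- **The weights at `θ = π/3`**: "if `θ = π/3`, then `w₂ = 0` and `v = w₁ = u₂ = u₁²`", with
`u₁ = x_c = 1/√(2+√2)` the honeycomb critical fugacity — the honeycomb self-avoiding walk drawn on
`ℤ²` (every vertex split along a diagonal: a corner arc uses one honeycomb vertex, a straight or
co-corner arc two, two corner arcs two distinct ones, two co-corner arcs are impossible). Collected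
from the tree's `weightU1_pi_div_three`, `weightU2_pi_div_three`, `weightV_pi_div_three`,
`weightW1_pi_div_three`, `weightW2_pi_div_three`. [cite: GlazmanManolescu2019, §1 ("if θ = π/3, then w₂ = 0 and v = w₁ = u₂ = u₁²")] -/
theorem weights_pi_div_three :
    weightU1 (π / 3) = hexCriticalFugacity ∧ weightU2 (π / 3) = hexCriticalFugacity ^ 2 ∧
      weightV (π / 3) = hexCriticalFugacity ^ 2 ∧ weightW1 (π / 3) = hexCriticalFugacity ^ 2 ∧
        weightW2 (π / 3) = 0 :=
  ⟨weightU1_pi_div_three, weightU2_pi_div_three, weightV_pi_div_three, weightW1_pi_div_three,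
    weightW2_pi_div_three⟩

/-- **The member `θ = π/3`** (weights `(x_c, x_c², x_c², x_c², 0)`, `weights_pi_div_three`: the
honeycomb self-avoiding walk drawn on `ℤ²`): coefficient `e^{7iπ/16}`, i.e.
`F_sq(z_E) − F_sq(z_W) = e^{7iπ/16} (F_sq(z_S) − F_sq(z_N))` — an exact identity ON THE SQUARE
LATTICE for a walk model whose only osculations are the two-corner ones.
[cite: GlazmanManolescu2019, Lemma 2.1 (θ = π/3) and §1] -/
theorem sqParafermion_relation_pi_div_three (T L : ℕ) (f : Face) (hf : f ∈ rect T L) :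
    sqParafermion T L (fun _ => π / 3) (f.side .E) - sqParafermion T L (fun _ => π / 3) (f.side .W) =
      Complex.exp (((7 * π / 16 : ℝ) : ℂ) * Complex.I) *
        (sqParafermion T L (fun _ => π / 3) (f.side .S) - sqParafermion T L (fun _ => π / 3) (f.side .N)) := by
  have h := sqParafermion_relation_const T L pi_div_three_mem_Icc f hf
  have : (3 / 8 * (π / 3) + 5 * π / 16 : ℝ) = 7 * π / 16 := by ring
  rw [this] at h
  exact h

/-! ### The family is anisotropic away from `θ = π/2` -/

/-- **Anisotropy of the printed weights**: on `[π/3, 2π/3]`, `u₁(θ) = u₂(θ)` iff `θ = π/2` (so every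
member `θ ≠ π/2` of the family weighs the two corner types of a vertex of `ℤ²` differently).
`u₁ − u₂ ∝ sin(5π/8 + 3θ/8) − sin(3θ/8) = 2 sin(5π/16) cos(5π/16 + 3θ/8)`, and
`5π/16 + 3θ/8 ∈ [7π/16, 9π/16]` vanishes under `cos` only at `θ = π/2`. [cite: GlazmanManolescu2019, eq. (1)] -/
theorem weightU1_eq_weightU2_iff {θ : ℝ} (hθ : θ ∈ Set.Icc (π / 3) (2 * π / 3)) :
    weightU1 θ = weightU2 θ ↔ θ = π / 2 := by
  have hden : weightDen θ ≠ 0 := (weightDen_neg hθ).ne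
  constructor
  · intro h
    rw [weightU1, weightU2, div_eq_div_iff hden hden] at h
    have h45 : sin (5 * π / 4) ≠ 0 := by
      rw [show (5 * π / 4 : ℝ) = π / 4 + π by ring, sin_add_pi, sin_pi_div_four]
      have : (0 : ℝ) < Real.sqrt 2 / 2 := by positivity
      intro h0
      linarith
    have hs : sin (5 * π / 8 + 3 * θ / 8) = sin (3 * θ / 8) := by
      have := mul_right_cancel₀ hden h
      exact mul_left_cancel₀ h45 this
    rw [← sub_eq_zero, sin_sub_sin] at hs
    have hcos : cos ((5 * π / 8 + 3 * θ / 8 + 3 * θ / 8) / 2) = 0 := by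
      have hsin : sin ((5 * π / 8 + 3 * θ / 8 - 3 * θ / 8) / 2) ≠ 0 := by
        rw [show ((5 * π / 8 + 3 * θ / 8 - 3 * θ / 8) / 2 : ℝ) = 5 * π / 16 by ring]
        exact (sin_pos_of_pos_of_lt_pi (by positivity) (by nlinarith [Real.pi_pos])).ne'
      rcases mul_eq_zero.1 hs with h1 | h1
      · rcases mul_eq_zero.1 h1 with h2 | h2
        · norm_num at h2
        · exact absurd h2 hsin
      · exact h1
    rw [Real.cos_eq_zero_iff] at hcos
    obtain ⟨n, hn⟩ := hcos
    obtain ⟨h1, h2⟩ := hθ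
    have hn0 : n = 0 := by
      have hπ := Real.pi_pos
      have h3 : (-1 : ℝ) < n := by nlinarith
      have h4 : (n : ℝ) < 1 := by nlinarith
      have h3' : (-1 : ℤ) < n := by exact_mod_cast h3
      have h4' : n < (1 : ℤ) := by exact_mod_cast h4
      omega
    subst hn0
    simp at hn
    nlinarith [Real.pi_pos]
  · rintro rfl
    rw [weightU1, weightU2]
    congr 1
    rw [show (5 * π / 8 + 3 * (π / 2) / 8 : ℝ) = π - 3 * (π / 2) / 8 by ring, sin_pi_sub]

end Literature.Probability.RandomPlanarGeometry.SAW.YangBaxter
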